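import Literature.Probability.LatticeModels.DartFlux
import Literature.Probability.LatticeModels.SHolomorphicPrimitiveLaplacian
import HarnessLib

/-!
# Lemma 3.8 for the discrete primitive of the FK observable, up to the boundary arcs

Topic `Literature/Probability/LatticeModels`; an instalment of the discharge programme for
crit-ising.S18 (`Sweep1Proofs.lean`: Smirnov's Theorem 2.2), node 2 of the DAG recorded there
(sub/superharmonicity of `H = Im ∫ F²`). `SHolomorphicPrimitiveLaplacian.lean` proves Smirnov's
Lemma 3.8 for primitive pairs of an abstract s-holomorphic function, reading the eight fluxes around
a square through s-holomorphicity at eight corners — which, for the FK observable, node 1 supplies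
only two lattice steps away from the arcs. Here the fluxes are Smirnov's own `|F(e)|² = dartFlux`
(`DartFlux.lean`), and Lemma 4.5 *at every interior medial vertex* (`dartObs_add_dartObs_partner_free`,
`dartObs_out_free`) lets us read all eight fluxes around a square at its four corner medial vertices
as soon as these four are interior in Smirnov's sense (`DiscreteDobrushin.IsInteriorEdge`: an edge of
`Ω_δ` with no endpoint on `B`, not an `A`–`A` edge, both faces inner) — exactly the printed
hypothesis "interior square = all four corner vertices interior" of Lemma 3.8, with no condition on
the outer edges. Everything here is proved.

* `sum_vertexStep_eq_neg_norm_sq'`, `sum_faceStep_eq_norm_sq'`: the Appendix C identities of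
  `SHolomorphicPrimitive.lean` with the outer fluxes written as projections of the values at the
  inner edges (same computation, s-holomorphicity at the four inner corners only).
* `projLine_cSrc_free`, `projLine_cTgt_free`: `Proj[F(e); ℓ(q)] = κ⁻¹ dartObs q` for every dart `q`
  sourced or targeted at an interior edge `e` (node 1's projection identities, weak hypotheses).
* `projLine_cornerLine_refPhase`, `dartFlux_eq_source`, `dartFlux_eq_target`, `isSHolAt_refPhase`:
  `dartFlux q = (κ²/‖refPhase‖²) · cornerFlux (refPhase • F) q` at interior edges, and
  `refPhase • F` is s-holomorphic across every corner joining two interior edges.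
* **`latticeLaplacian_hw_eq`**, **`latticeLaplacian_hb_eq`** (Lemma 3.8 for the FK primitive): for
  any pair `(Hw, Hb)` with the primitive property at the eight darts around a site `u` (resp. a face
  `f`) whose four edges (resp. sides) are interior, `Δ Hw (u) = -κ² ‖F(e₀) - F(e₂)‖² ≤ 0` and
  `Δ Hb (f) = κ² ‖F(E₀) - F(E₂)‖² ≥ 0` (`κ = cos(π/8)`): `Hw` is superharmonic and `Hb`
  subharmonic one lattice step inside the arcs (`superharmonic_hw`, `subharmonic_hb`).

## References

* S. Smirnov, *Conformal invariance in random cluster models. I*, Ann. of Math. 172 (2010)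
  1435–1467: Lemma 3.8 with Appendix C, Lemma 4.5 with Remark 4.6 — bib key `Smirnov2010`.
-/

noncomputable section

namespace Literature.Probability.LatticeModels

open Finset Complex

/-! ### Appendix C with the outer fluxes read at the inner edges -/

/-- **Lemma 3.8, white squares, inner corners only.** As `sum_vertexStep_eq_neg_norm_sq`, with the
four outer fluxes already written as the squared projections of `F(e_k)` onto the lines of the
arriving corners `(u + e_k, k + 1)`: only s-holomorphicity at the four corners `(u, k)` is needed.
[cite: Smirnov2010, Lemma 3.8 and Appendix C] -/
theorem sum_vertexStep_eq_neg_norm_sq' (F : MedialVertex → ℂ) (u : Site 2)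
    (h : ∀ k : Fin 4, IsSHolAt F (u, k)) :
    ∑ k : Fin 4, (cornerFlux F (u, k) -
      ‖projLine (cornerLine (u + cornerUnit k) (faceAt (u + cornerUnit k) (k + 1))) (F (cSrc (u, k)))‖ ^ 2) =
      -‖F (cSrc (u, 0)) - F (cSrc (u, 2))‖ ^ 2 := by
  obtain ⟨r0, r1, -, r3⟩ := re_mul_one_add_I_pow (frameCoord u (F (cSrc (u, 0))))
  obtain ⟨s0, s1, s2, -⟩ := re_mul_one_add_I_pow (frameCoord u (F (cSrc (u, 1))))
  obtain ⟨-, t1, t2, t3⟩ := re_mul_one_add_I_pow (frameCoord u (F (cSrc (u, 2))))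
  obtain ⟨w0, -, w2, w3⟩ := re_mul_one_add_I_pow (frameCoord u (F (cSrc (u, 3))))
  -- inner fluxes
  have e0 : cornerFlux F (u, 0) = (frameCoord u (F (cSrc (u, 0)))).re ^ 2 / (Real.sqrt 2 * 2 ^ 0) := by
    show ‖projLine (cornerLine u (faceAt u 0)) (F (cSrc (u, 0)))‖ ^ 2 = _
    rw [norm_projLine_cornerLine_sq u u 0 (n := 0) rfl, r0]
  have e1 : cornerFlux F (u, 1) = ((frameCoord u (F (cSrc (u, 1)))).re -
      (frameCoord u (F (cSrc (u, 1)))).im) ^ 2 / (Real.sqrt 2 * 2 ^ 1) := by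
    show ‖projLine (cornerLine u (faceAt u 1)) (F (cSrc (u, 1)))‖ ^ 2 = _
    rw [norm_projLine_cornerLine_sq u u 1 (n := 1) rfl, s1]
  have e2 : cornerFlux F (u, 2) = (-2 * (frameCoord u (F (cSrc (u, 2)))).im) ^ 2 /
      (Real.sqrt 2 * 2 ^ 2) := by
    show ‖projLine (cornerLine u (faceAt u 2)) (F (cSrc (u, 2)))‖ ^ 2 = _
    rw [norm_projLine_cornerLine_sq u u 2 (n := 2) rfl, t2]
  have e3 : cornerFlux F (u, 3) = (-2 * (frameCoord u (F (cSrc (u, 3)))).re -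
      2 * (frameCoord u (F (cSrc (u, 3)))).im) ^ 2 / (Real.sqrt 2 * 2 ^ 3) := by
    show ‖projLine (cornerLine u (faceAt u 3)) (F (cSrc (u, 3)))‖ ^ 2 = _
    rw [norm_projLine_cornerLine_sq u u 3 (n := 3) rfl, w3]
  -- outer fluxes, read at `e_k`
  have f0 : ‖projLine (cornerLine (u + cornerUnit 0) (faceAt (u + cornerUnit 0) (0 + 1))) (F (cSrc (u, 0)))‖ ^ 2 = ((frameCoord u (F (cSrc (u, 0)))).re -
      (frameCoord u (F (cSrc (u, 0)))).im) ^ 2 / (Real.sqrt 2 * 2 ^ 1) := by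
    rw [norm_projLine_cornerLine_sq u _ (0 + 1) (n := 1) rfl, r1]
  have f1 : ‖projLine (cornerLine (u + cornerUnit 1) (faceAt (u + cornerUnit 1) (1 + 1))) (F (cSrc (u, 1)))‖ ^ 2 = (-2 * (frameCoord u (F (cSrc (u, 1)))).im) ^ 2 /
      (Real.sqrt 2 * 2 ^ 2) := by
    rw [norm_projLine_cornerLine_sq u _ (1 + 1) (n := 2) rfl, s2]
  have f2 : ‖projLine (cornerLine (u + cornerUnit 2) (faceAt (u + cornerUnit 2) (2 + 1))) (F (cSrc (u, 2)))‖ ^ 2 = (-2 * (frameCoord u (F (cSrc (u, 2)))).re -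
      2 * (frameCoord u (F (cSrc (u, 2)))).im) ^ 2 / (Real.sqrt 2 * 2 ^ 3) := by
    rw [norm_projLine_cornerLine_sq u _ (2 + 1) (n := 3) rfl, t3]
  have f3 : ‖projLine (cornerLine (u + cornerUnit 3) (faceAt (u + cornerUnit 3) (3 + 1))) (F (cSrc (u, 3)))‖ ^ 2 = (frameCoord u (F (cSrc (u, 3)))).re ^ 2 /
      (Real.sqrt 2 * 2 ^ 0) := by
    rw [norm_projLine_cornerLine_sq u _ (3 + 1) (n := 0) rfl, w0]
  -- the four relations around `u`
  have c0 : (frameCoord u (F (cSrc (u, 0)))).re = (frameCoord u (F (cSrc (u, 1)))).re := by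
    have hc := (projLine_cornerLine_eq_iff u u 0 (n := 0) rfl _ _).1 (h 0)
    rwa [show cTgt (u, 0) = cSrc (u, 1) from rfl, r0, s0] at hc
  have c1 : (frameCoord u (F (cSrc (u, 1)))).re - (frameCoord u (F (cSrc (u, 1)))).im =
      (frameCoord u (F (cSrc (u, 2)))).re - (frameCoord u (F (cSrc (u, 2)))).im := by
    have hc := (projLine_cornerLine_eq_iff u u 1 (n := 1) rfl _ _).1 (h 1)
    rwa [show cTgt (u, 1) = cSrc (u, 2) from rfl, s1, t1] at hc
  have c2 : -2 * (frameCoord u (F (cSrc (u, 2)))).im = -2 * (frameCoord u (F (cSrc (u, 3)))).im := by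
    have hc := (projLine_cornerLine_eq_iff u u 2 (n := 2) rfl _ _).1 (h 2)
    rwa [show cTgt (u, 2) = cSrc (u, 3) from rfl, t2, w2] at hc
  have c3 : -2 * (frameCoord u (F (cSrc (u, 3)))).re - 2 * (frameCoord u (F (cSrc (u, 3)))).im =
      -2 * (frameCoord u (F (cSrc (u, 0)))).re - 2 * (frameCoord u (F (cSrc (u, 0)))).im := by
    have hc := (projLine_cornerLine_eq_iff u u 3 (n := 3) rfl _ _).1 (h 3)
    rwa [show cTgt (u, 3) = cSrc (u, 0) from rfl, w3, r3] at hc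
  -- the right-hand side in the frame
  have hs : (Real.sqrt 2 : ℝ) ≠ 0 := (Real.sqrt_pos.2 two_pos).ne'
  have hn : ‖F (cSrc (u, 0)) - F (cSrc (u, 2))‖ ^ 2 =
      ((frameCoord u (F (cSrc (u, 0))) - frameCoord u (F (cSrc (u, 2)))).re ^ 2 +
        (frameCoord u (F (cSrc (u, 0))) - frameCoord u (F (cSrc (u, 2)))).im ^ 2) / Real.sqrt 2 := by
    rw [eq_div_iff hs, ← frameCoord_sub, ← norm_frameCoord_sq, Complex.sq_norm, normSq_apply]
    ring
  rw [Fin.sum_univ_four, e0, e1, e2, e3, f0, f1, f2, f3, hn]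
  simp only [sub_re, sub_im]
  set x₀ := (frameCoord u (F (cSrc (u, 0)))).re
  set y₀ := (frameCoord u (F (cSrc (u, 0)))).im
  set x₁ := (frameCoord u (F (cSrc (u, 1)))).re
  set y₁ := (frameCoord u (F (cSrc (u, 1)))).im
  set x₂ := (frameCoord u (F (cSrc (u, 2)))).re
  set y₂ := (frameCoord u (F (cSrc (u, 2)))).im
  set x₃ := (frameCoord u (F (cSrc (u, 3)))).re
  set y₃ := (frameCoord u (F (cSrc (u, 3)))).im
  have key := appendixC_white_identity x₀ y₀ x₁ y₁ x₂ y₂ x₃ y₃ c0 c1 (by linarith) (by linarith)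
  linear_combination (1 / Real.sqrt 2) * key


/-- **Lemma 3.8, black squares, inner corners only.** As `sum_faceStep_eq_norm_sq`, with the four
outer fluxes written as the squared projections of `F(E_j)` onto the lines of the arriving corners
`(f + cornerOff j, j + 3)`: only s-holomorphicity at the four corners of the face is needed.
[cite: Smirnov2010, Lemma 3.8 and Appendix C] -/
theorem sum_faceStep_eq_norm_sq' (F : MedialVertex → ℂ) (f : Site 2)
    (h : ∀ j : Fin 4, IsSHolAt F (f + cornerOff j, j)) :
    ∑ j : Fin 4, (‖projLine (cornerLine (f + cornerOff j) (faceAt (f + cornerOff j) (j + 3))) (F (cSrc (f + cornerOff j, j)))‖ ^ 2 -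
      cornerFlux F (f + cornerOff j, j)) =
      ‖F (cSrc (f + cornerOff 0, 0)) - F (cSrc (f + cornerOff 2, 2))‖ ^ 2 := by
  obtain ⟨r0, r1, -, r3⟩ := re_mul_one_add_I_pow (frameCoord f (F (cSrc (f + cornerOff 0, 0))))
  obtain ⟨s0, s1, s2, -⟩ := re_mul_one_add_I_pow (frameCoord f (F (cSrc (f + cornerOff 1, 1))))
  obtain ⟨-, t1, t2, t3⟩ := re_mul_one_add_I_pow (frameCoord f (F (cSrc (f + cornerOff 2, 2))))
  obtain ⟨w0, -, w2, w3⟩ := re_mul_one_add_I_pow (frameCoord f (F (cSrc (f + cornerOff 3, 3))))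
  -- inner fluxes (corners of the face, lines `j`)
  have e0 : cornerFlux F (f + cornerOff 0, 0) =
      (frameCoord f (F (cSrc (f + cornerOff 0, 0)))).re ^ 2 / (Real.sqrt 2 * 2 ^ 0) := by
    show ‖projLine (cornerLine (f + cornerOff 0) (faceAt (f + cornerOff 0) 0))
      (F (cSrc (f + cornerOff 0, 0)))‖ ^ 2 = _
    rw [norm_projLine_cornerLine_sq f _ 0 (n := 0) rfl, r0]
  have e1 : cornerFlux F (f + cornerOff 1, 1) = ((frameCoord f (F (cSrc (f + cornerOff 1, 1)))).re -
      (frameCoord f (F (cSrc (f + cornerOff 1, 1)))).im) ^ 2 / (Real.sqrt 2 * 2 ^ 1) := by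
    show ‖projLine (cornerLine (f + cornerOff 1) (faceAt (f + cornerOff 1) 1))
      (F (cSrc (f + cornerOff 1, 1)))‖ ^ 2 = _
    rw [norm_projLine_cornerLine_sq f _ 1 (n := 1) rfl, s1]
  have e2 : cornerFlux F (f + cornerOff 2, 2) = (-2 * (frameCoord f (F (cSrc (f + cornerOff 2, 2)))).im) ^ 2 /
      (Real.sqrt 2 * 2 ^ 2) := by
    show ‖projLine (cornerLine (f + cornerOff 2) (faceAt (f + cornerOff 2) 2))
      (F (cSrc (f + cornerOff 2, 2)))‖ ^ 2 = _
    rw [norm_projLine_cornerLine_sq f _ 2 (n := 2) rfl, t2]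
  have e3 : cornerFlux F (f + cornerOff 3, 3) = (-2 * (frameCoord f (F (cSrc (f + cornerOff 3, 3)))).re -
      2 * (frameCoord f (F (cSrc (f + cornerOff 3, 3)))).im) ^ 2 / (Real.sqrt 2 * 2 ^ 3) := by
    show ‖projLine (cornerLine (f + cornerOff 3) (faceAt (f + cornerOff 3) 3))
      (F (cSrc (f + cornerOff 3, 3)))‖ ^ 2 = _
    rw [norm_projLine_cornerLine_sq f _ 3 (n := 3) rfl, w3]
  -- outer fluxes (lines `j + 3`), read at `E_j`
  have f0 : ‖projLine (cornerLine (f + cornerOff 0) (faceAt (f + cornerOff 0) (0 + 3))) (F (cSrc (f + cornerOff 0, 0)))‖ ^ 2 = (-2 * (frameCoord f (F (cSrc (f + cornerOff 0, 0)))).re -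
      2 * (frameCoord f (F (cSrc (f + cornerOff 0, 0)))).im) ^ 2 / (Real.sqrt 2 * 2 ^ 3) := by
    rw [norm_projLine_cornerLine_sq f _ (0 + 3) (n := 3) rfl, r3]
  have f1 : ‖projLine (cornerLine (f + cornerOff 1) (faceAt (f + cornerOff 1) (1 + 3))) (F (cSrc (f + cornerOff 1, 1)))‖ ^ 2 =
      (frameCoord f (F (cSrc (f + cornerOff 1, 1)))).re ^ 2 / (Real.sqrt 2 * 2 ^ 0) := by
    rw [norm_projLine_cornerLine_sq f _ (1 + 3) (n := 0) rfl, s0]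
  have f2 : ‖projLine (cornerLine (f + cornerOff 2) (faceAt (f + cornerOff 2) (2 + 3))) (F (cSrc (f + cornerOff 2, 2)))‖ ^ 2 = ((frameCoord f (F (cSrc (f + cornerOff 2, 2)))).re -
      (frameCoord f (F (cSrc (f + cornerOff 2, 2)))).im) ^ 2 / (Real.sqrt 2 * 2 ^ 1) := by
    rw [norm_projLine_cornerLine_sq f _ (2 + 3) (n := 1) rfl, t1]
  have f3 : ‖projLine (cornerLine (f + cornerOff 3) (faceAt (f + cornerOff 3) (3 + 3))) (F (cSrc (f + cornerOff 3, 3)))‖ ^ 2 = (-2 * (frameCoord f (F (cSrc (f + cornerOff 3, 3)))).im) ^ 2 /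
      (Real.sqrt 2 * 2 ^ 2) := by
    rw [norm_projLine_cornerLine_sq f _ (3 + 3) (n := 2) rfl, w2]
  -- the four relations at the corners of the face (`E_j` and `E_{j+3}` project equally onto `ℓ_j`)
  have c0 : (frameCoord f (F (cSrc (f + cornerOff 0, 0)))).re =
      (frameCoord f (F (cSrc (f + cornerOff 3, 3)))).re := by
    have hc := (projLine_cornerLine_eq_iff f (f + cornerOff 0) 0 (n := 0) rfl _ _).1 (h 0)
    rwa [cTgt_face_corner f (j := 0) (i := 3) (by decide), r0, w0] at hc
  have c1 : (frameCoord f (F (cSrc (f + cornerOff 1, 1)))).re - (frameCoord f (F (cSrc (f + cornerOff 1, 1)))).im =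
      (frameCoord f (F (cSrc (f + cornerOff 0, 0)))).re - (frameCoord f (F (cSrc (f + cornerOff 0, 0)))).im := by
    have hc := (projLine_cornerLine_eq_iff f (f + cornerOff 1) 1 (n := 1) rfl _ _).1 (h 1)
    rwa [cTgt_face_corner f (j := 1) (i := 0) (by decide), s1, r1] at hc
  have c2 : -2 * (frameCoord f (F (cSrc (f + cornerOff 2, 2)))).im =
      -2 * (frameCoord f (F (cSrc (f + cornerOff 1, 1)))).im := by
    have hc := (projLine_cornerLine_eq_iff f (f + cornerOff 2) 2 (n := 2) rfl _ _).1 (h 2)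
    rwa [cTgt_face_corner f (j := 2) (i := 1) (by decide), t2, s2] at hc
  have c3 : -2 * (frameCoord f (F (cSrc (f + cornerOff 3, 3)))).re - 2 * (frameCoord f (F (cSrc (f + cornerOff 3, 3)))).im =
      -2 * (frameCoord f (F (cSrc (f + cornerOff 2, 2)))).re - 2 * (frameCoord f (F (cSrc (f + cornerOff 2, 2)))).im := by
    have hc := (projLine_cornerLine_eq_iff f (f + cornerOff 3) 3 (n := 3) rfl _ _).1 (h 3)
    rwa [cTgt_face_corner f (j := 3) (i := 2) (by decide), w3, t3] at hc
  -- the right-hand side in the frame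
  have hs : (Real.sqrt 2 : ℝ) ≠ 0 := (Real.sqrt_pos.2 two_pos).ne'
  have hn : ‖F (cSrc (f + cornerOff 0, 0)) - F (cSrc (f + cornerOff 2, 2))‖ ^ 2 =
      ((frameCoord f (F (cSrc (f + cornerOff 0, 0))) - frameCoord f (F (cSrc (f + cornerOff 2, 2)))).re ^ 2 +
        (frameCoord f (F (cSrc (f + cornerOff 0, 0))) - frameCoord f (F (cSrc (f + cornerOff 2, 2)))).im ^ 2) /
          Real.sqrt 2 := by
    rw [eq_div_iff hs, ← frameCoord_sub, ← norm_frameCoord_sq, Complex.sq_norm, normSq_apply]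
    ring
  rw [Fin.sum_univ_four, e0, e1, e2, e3, f0, f1, f2, f3, hn]
  simp only [sub_re, sub_im]
  set x₀ := (frameCoord f (F (cSrc (f + cornerOff 0, 0)))).re
  set y₀ := (frameCoord f (F (cSrc (f + cornerOff 0, 0)))).im
  set x₁ := (frameCoord f (F (cSrc (f + cornerOff 1, 1)))).re
  set y₁ := (frameCoord f (F (cSrc (f + cornerOff 1, 1)))).im
  set x₂ := (frameCoord f (F (cSrc (f + cornerOff 2, 2)))).re
  set y₂ := (frameCoord f (F (cSrc (f + cornerOff 2, 2)))).im
  set x₃ := (frameCoord f (F (cSrc (f + cornerOff 3, 3)))).re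
  set y₃ := (frameCoord f (F (cSrc (f + cornerOff 3, 3)))).im
  have key := appendixC_black_identity x₀ y₀ x₁ y₁ x₂ y₂ x₃ y₃ c0 c1 (by linarith) (by linarith)
  linear_combination (1 / Real.sqrt 2) * key

/-! ### Interior edges in Smirnov's sense -/

namespace DiscreteDobrushin

/-- **An interior medial vertex in Smirnov's sense**, for the tree's Dobrushin data: the edge
`e_k = {u, u + e_k}` of `Ω_δ` (written `cSrc (u, k)`) has no endpoint on the free arc `B`, is not an
`A`–`A` edge (so its status is random), and both its faces `faceAt u k`, `faceAt u (k + 3)` are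
inner — all four medial edges at it are available to the interface and Lemma 4.5 holds there
(`dartFlux_closed_free`). Edges with one endpoint on the wired arc `A` are included.
[cite: Smirnov2010, §3 ("interior vertex") and Remark 4.6] -/
structure IsInteriorEdge (E : DiscreteDobrushin) (u : Site 2) (k : Fin 4) : Prop where
  /-- The edge is an edge of `Ω_δ`. -/
  mem_edgeSet : cSrc (u, k) ∈ (discreteDomainGraph E.Ω E.δ).edgeSet
  /-- No endpoint lies on the free arc. -/
  not_mem_zdArcB : ∀ x ∈ cSrc (u, k), x ∉ E.zdArcB
  /-- Not both endpoints lie on the wired arc. -/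
  not_arcA : ¬ (u ∈ E.zdArcA ∧ u + cornerUnit k ∈ E.zdArcA)
  /-- The face on one side is inner. -/
  inner : E.IsInnerFace (faceAt u k)
  /-- The face on the other side is inner. -/
  inner' : E.IsInnerFace (faceAt u (k + 3))

/-- The same edge seen from its other endpoint is interior too. [cite: Smirnov2010, §3] -/
theorem IsInteriorEdge.reverse {E : DiscreteDobrushin} {u : Site 2} {k : Fin 4} (h : E.IsInteriorEdge u k) :
    E.IsInteriorEdge (u + cornerUnit k) (k + 2) where
  mem_edgeSet := by rw [cSrc_add_cornerUnit_add_two]; exact h.mem_edgeSet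
  not_mem_zdArcB := by rw [cSrc_add_cornerUnit_add_two]; exact h.not_mem_zdArcB
  not_arcA := by
    rw [cornerUnit_add_two, ← sub_eq_add_neg, add_sub_cancel_right]
    exact fun h' => h.not_arcA ⟨h'.2, h'.1⟩
  inner := by rw [faceAt_add_unit_add_two]; exact h.inner'
  inner' := by rw [show k + 2 + 3 = k + 1 by omega, faceAt_add_unit_succ]; exact h.inner

end DiscreteDobrushin

/-! ### The projection identities at interior edges -/

section Proj

variable {E : DiscreteDobrushin}

/-- **Projection identity at the target, interior edges**: for a dart `p` whose target edge
`cTgt p = cSrc (p.1, p.2 + 1)` is interior, `Proj[F(cTgt p); ℓ(p)] = κ⁻¹ · dartObs p`.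
[cite: Smirnov2010, proof of Lemma 4.5] -/
theorem projLine_cTgt_free (hE : E.IsZdAdmissible) [Fintype (meshDomain E.Ω E.δ)]
    (hA : ((discreteDomainGraph E.Ω E.δ).induce E.zdArcA).Preconnected) {p : Site 2 × Fin 4}
    (hp : E.IsInteriorEdge p.1 (p.2 + 1)) :
    projLine (quarterPhase (dartDir (DiscreteDobrushin.startCorner hE) p)) (fkIsingObservable E criticalFKIsingParam (cTgt p)) =
      (((eighthPhase 1).re)⁻¹ : ℝ) * dartObs E hE p := by
  have he : cTgt p ∈ (discreteDomainGraph E.Ω E.δ).edgeSet := hp.mem_edgeSet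
  have hB : ∀ x ∈ cTgt p, x ∉ E.zdArcB := hp.not_mem_zdArcB
  have hpf : E.IsInnerFace (cFace p) := by
    change E.IsInnerFace (faceAt p.1 p.2); rw [show p.2 = p.2 + 1 + 3 by omega]; exact hp.inner'
  have hp₂f : E.IsInnerFace (cFace (cornerPartner p)) := by
    change E.IsInnerFace (faceAt (p.1 + cornerUnit (p.2 + 1)) (p.2 + 2))
    rw [show p.2 + 2 = p.2 + 1 + 1 by omega, faceAt_add_unit_succ]; exact hp.inner
  have hk := dartObs_add_dartObs_partner_free hE hA he hB hp.not_arcA hpf hp₂f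
  have hkr : ((eighthPhase 1).re : ℝ) ≠ 0 := by
    have := kappa_ne_zero; rw [kappa_eq_re] at this; exact_mod_cast this
  have hF : fkIsingObservable E criticalFKIsingParam (cTgt p) =
      (((eighthPhase 1).re)⁻¹ : ℝ) * (dartObs E hE p + dartObs E hE (cornerPartner p)) := by
    rw [hk, kappa_eq_re, ← mul_assoc]; push_cast; rw [inv_mul_cancel₀ (by exact_mod_cast hkr), one_mul]
  obtain ⟨t, ht⟩ := dartObs_mem_line hE p
  obtain ⟨t', ht'⟩ := dartObs_mem_line hE (cornerPartner p)
  have hη : quarterPhase (dartDir (DiscreteDobrushin.startCorner hE) p) ≠ 0 :=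
    norm_ne_zero_iff.1 (by rw [norm_quarterPhase]; exact one_ne_zero)
  rw [hF, projLine_real_mul_right, projLine_add, ht, projLine_real_mul_self hη, ht']
  rcases quarterPhase_dartDir_add_two (DiscreteDobrushin.startCorner hE) p (cornerPartner p) rfl with h | h
  · rw [h, projLine_I_mul_self, add_zero]
  · rw [h, show (t' : ℂ) * -(I * quarterPhase (dartDir (DiscreteDobrushin.startCorner hE) p)) =
      ((-t' : ℝ) : ℂ) * (I * quarterPhase (dartDir (DiscreteDobrushin.startCorner hE) p)) by push_cast; ring,
      projLine_I_mul_self, add_zero]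

/-- **Projection identity at the source, interior edges**: for a dart `r` whose source edge is
interior, `Proj[F(cSrc r); ℓ(r)] = κ⁻¹ · dartObs r`. [cite: Smirnov2010, proof of Lemma 4.5] -/
theorem projLine_cSrc_free (hE : E.IsZdAdmissible) [Fintype (meshDomain E.Ω E.δ)]
    (hA : ((discreteDomainGraph E.Ω E.δ).induce E.zdArcA).Preconnected) {r : Site 2 × Fin 4}
    (hr : E.IsInteriorEdge r.1 r.2) :
    projLine (quarterPhase (dartDir (DiscreteDobrushin.startCorner hE) r)) (fkIsingObservable E criticalFKIsingParam (cSrc r)) =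
      (((eighthPhase 1).re)⁻¹ : ℝ) * dartObs E hE r := by
  have hrot : cTgt (r.1, r.2 + 3) = cSrc r := cTgt_crossPred r
  have h31 : r.2 + 3 + 1 = r.2 := by omega
  have he : cTgt (r.1, r.2 + 3) ∈ (discreteDomainGraph E.Ω E.δ).edgeSet := by rw [hrot]; exact hr.mem_edgeSet
  have hB : ∀ x ∈ cTgt ((r.1, r.2 + 3) : Site 2 × Fin 4), x ∉ E.zdArcB := by rw [hrot]; exact hr.not_mem_zdArcB
  have hpA : ¬ (r.1 ∈ E.zdArcA ∧ r.1 + cornerUnit (r.2 + 3 + 1) ∈ E.zdArcA) := by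
    rw [h31]; exact hr.not_arcA
  have hpf : E.IsInnerFace (cFace ((r.1, r.2 + 3) : Site 2 × Fin 4)) := hr.inner'
  have hp₂f : E.IsInnerFace (cFace (cornerPartner ((r.1, r.2 + 3) : Site 2 × Fin 4))) := by
    change E.IsInnerFace (faceAt (r.1 + cornerUnit (r.2 + 3 + 1)) (r.2 + 3 + 2))
    rw [h31, show r.2 + 3 + 2 = r.2 + 1 by omega, faceAt_add_unit_succ]; exact hr.inner
  have hk := dartObs_out_free hE hA he hB hpA hpf hp₂f
  have hr' : ((r.1, r.2 + 3 + 1) : Site 2 × Fin 4) = r := Prod.ext rfl h31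
  simp only [hr'] at hk
  rw [hrot] at hk
  have hkr : ((eighthPhase 1).re : ℝ) ≠ 0 := by
    have := kappa_ne_zero; rw [kappa_eq_re] at this; exact_mod_cast this
  set r' : Site 2 × Fin 4 := (r.1 + cornerUnit (r.2 + 3 + 1), r.2 + 3 + 3) with hr'def
  have hF : fkIsingObservable E criticalFKIsingParam (cSrc r) =
      (((eighthPhase 1).re)⁻¹ : ℝ) * (dartObs E hE r + dartObs E hE r') := by
    rw [hk, kappa_eq_re, ← mul_assoc]; push_cast; rw [inv_mul_cancel₀ (by exact_mod_cast hkr), one_mul]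
  obtain ⟨t, ht⟩ := dartObs_mem_line hE r
  obtain ⟨t', ht'⟩ := dartObs_mem_line hE r'
  have hη : quarterPhase (dartDir (DiscreteDobrushin.startCorner hE) r) ≠ 0 :=
    norm_ne_zero_iff.1 (by rw [norm_quarterPhase]; exact one_ne_zero)
  rw [hF, projLine_real_mul_right, projLine_add, ht, projLine_real_mul_self hη, ht']
  rcases quarterPhase_dartDir_add_two (DiscreteDobrushin.startCorner hE) r r' (by rw [hr'def]; simp only; omega) with h | h
  · rw [h, projLine_I_mul_self, add_zero]
  · rw [h, show (t' : ℂ) * -(I * quarterPhase (dartDir (DiscreteDobrushin.startCorner hE) r)) =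
      ((-t' : ℝ) : ℂ) * (I * quarterPhase (dartDir (DiscreteDobrushin.startCorner hE) r)) by push_cast; ring,
      projLine_I_mul_self, add_zero]

/-- **H21's `cornerLine` is the reference phase times the dart line**: projecting `refPhase c₀ · G`
onto `cornerLine` is `refPhase c₀` times the projection of `G` onto `quarterPhase (dartDir c₀ q)`.
[cite: Smirnov2010, Def. 3.1] -/
theorem projLine_cornerLine_refPhase (c₀ q : Site 2 × Fin 4) (G : ℂ) :
    projLine (cornerLine q.1 (cFace q)) (refPhase c₀ * G) = refPhase c₀ * projLine (quarterPhase (dartDir c₀ q)) G := by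
  have hsq : Real.sqrt (Real.sqrt 2) ≠ 0 := (Real.sqrt_pos.2 (Real.sqrt_pos.2 two_pos)).ne'
  rcases cornerLine_eq_or_eq_neg c₀ q with h | h
  · rw [h, projLine_real_mul hsq, projLine_mul_mul (refPhase_ne_zero c₀)]
  · rw [h, projLine_neg, projLine_real_mul hsq, projLine_mul_mul (refPhase_ne_zero c₀)]

/-- The constant `κ² / ‖refPhase c₀‖²` converting H21's `cornerFlux (refPhase c₀ • F)` into
Smirnov's `dartFlux`. [cite: Smirnov2010, Lemma 3.6] -/
def fluxConst (c₀ : Site 2 × Fin 4) : ℝ := (eighthPhase 1).re ^ 2 / ‖refPhase c₀‖ ^ 2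

/-- `fluxConst c₀ > 0`. [cite: Smirnov2010, Lemma 3.6] -/
theorem fluxConst_pos (c₀ : Site 2 × Fin 4) : 0 < fluxConst c₀ := by
  have hkr : ((eighthPhase 1).re : ℝ) ≠ 0 := by
    have := kappa_ne_zero; rw [kappa_eq_re] at this; exact_mod_cast this
  exact div_pos (lt_of_le_of_ne (sq_nonneg _) (Ne.symm (pow_ne_zero 2 hkr)))
    (pow_pos (norm_pos_iff.2 (refPhase_ne_zero c₀)) 2)

/-- From `Proj[F(e); ℓ] = κ⁻¹ dartObs q` to `dartFlux q = (κ²/‖refPhase‖²) ‖Proj[refPhase F(e); cornerLine q]‖²`. [cite: Smirnov2010, Lemma 3.6] -/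
theorem dartFlux_eq_of_projLine (hE : E.IsZdAdmissible) [Fintype (meshDomain E.Ω E.δ)] {q : Site 2 × Fin 4} {X : ℂ}
    (h : projLine (quarterPhase (dartDir (DiscreteDobrushin.startCorner hE) q)) X = (((eighthPhase 1).re)⁻¹ : ℝ) * dartObs E hE q) :
    dartFlux E hE q = fluxConst (DiscreteDobrushin.startCorner hE) *
      ‖projLine (cornerLine q.1 (cFace q)) (refPhase (DiscreteDobrushin.startCorner hE) * X)‖ ^ 2 := by
  set c₀ := DiscreteDobrushin.startCorner hE
  have hkr : ((eighthPhase 1).re : ℝ) ≠ 0 := by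
    have := kappa_ne_zero; rw [kappa_eq_re] at this; exact_mod_cast this
  have hR : ‖refPhase c₀‖ ≠ 0 := norm_ne_zero_iff.2 (refPhase_ne_zero c₀)
  rw [projLine_cornerLine_refPhase, h, norm_mul, norm_mul, Complex.norm_real, Real.norm_eq_abs, abs_inv, mul_pow, mul_pow,
    inv_pow, sq_abs, fluxConst, dartFlux]
  field_simp

/-- **`dartFlux` at an interior source edge is the rescaled `cornerFlux` of `refPhase • F`.** [cite: Smirnov2010, Lemma 3.6] -/
theorem dartFlux_eq_source (hE : E.IsZdAdmissible) [Fintype (meshDomain E.Ω E.δ)]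
    (hA : ((discreteDomainGraph E.Ω E.δ).induce E.zdArcA).Preconnected) {r : Site 2 × Fin 4}
    (hr : E.IsInteriorEdge r.1 r.2) :
    dartFlux E hE r = fluxConst (DiscreteDobrushin.startCorner hE) *
      cornerFlux (fun z => refPhase (DiscreteDobrushin.startCorner hE) * fkIsingObservable E criticalFKIsingParam z) r :=
  dartFlux_eq_of_projLine hE (projLine_cSrc_free hE hA hr)

/-- **`dartFlux` at an interior target edge, read at the target.** [cite: Smirnov2010, Lemma 3.6] -/
theorem dartFlux_eq_target (hE : E.IsZdAdmissible) [Fintype (meshDomain E.Ω E.δ)]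
    (hA : ((discreteDomainGraph E.Ω E.δ).induce E.zdArcA).Preconnected) {p : Site 2 × Fin 4}
    (hp : E.IsInteriorEdge p.1 (p.2 + 1)) :
    dartFlux E hE p = fluxConst (DiscreteDobrushin.startCorner hE) *
      ‖projLine (cornerLine p.1 (cFace p)) (refPhase (DiscreteDobrushin.startCorner hE) *
        fkIsingObservable E criticalFKIsingParam (cTgt p))‖ ^ 2 :=
  dartFlux_eq_of_projLine hE (projLine_cTgt_free hE hA hp)

/-- **`refPhase • F` is s-holomorphic across every corner joining two interior edges** (Lemma 4.5
with Remark 4.6, weak hypotheses; H21's `IsSHolAt`). [cite: Smirnov2010, Lemma 4.5 and Remark 4.6] -/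
theorem isSHolAt_refPhase (hE : E.IsZdAdmissible) [Fintype (meshDomain E.Ω E.δ)]
    (hA : ((discreteDomainGraph E.Ω E.δ).induce E.zdArcA).Preconnected) {r : Site 2 × Fin 4}
    (hsrc : E.IsInteriorEdge r.1 r.2) (htgt : E.IsInteriorEdge r.1 (r.2 + 1)) :
    IsSHolAt (fun z => refPhase (DiscreteDobrushin.startCorner hE) * fkIsingObservable E criticalFKIsingParam z) r := by
  unfold IsSHolAt
  rw [projLine_cornerLine_refPhase, projLine_cornerLine_refPhase, projLine_cSrc_free hE hA hsrc, projLine_cTgt_free hE hA htgt]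

end Proj

/-! ### Lemma 3.8 for pairs with the dart-flux primitive property -/

section Laplacian

variable {E : DiscreteDobrushin}

/-- `cornerOff (j + 3) + cornerUnit (j + 3) = cornerOff j`: the side `E_{j+3}` of a face ends at
its `j`-th corner. [folklore] -/
theorem cornerOff_add_three_add_cornerUnit (j : Fin 4) : cornerOff (j + 3) + cornerUnit (j + 3) = cornerOff j := by
  fin_cases j <;> decide

/-- **Lemma 3.8 (white squares) for the FK primitive.** Let `(Hw, Hb)` have the primitive property
`Hb - Hw = |F(·)|²` at the eight darts around the site `u` (the four darts `(u, k)` of `u` and the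
four darts `(u + e_k, k + 1)` arriving at its edges), and let the four edges `e_k` at `u` be interior
(`IsInteriorEdge`; for admissible data with connected wired arc). Then
`Δ Hw (u) = -κ² ‖F(e₀) - F(e₂)‖²`, `κ = cos(π/8)` — in particular `Δ Hw (u) ≤ 0`.
[cite: Smirnov2010, Lemma 3.8] -/
theorem latticeLaplacian_hw_eq (hE : E.IsZdAdmissible) [Fintype (meshDomain E.Ω E.δ)]
    (hA : ((discreteDomainGraph E.Ω E.δ).induce E.zdArcA).Preconnected) {Hw Hb : Site 2 → ℝ} (u : Site 2)
    (hint : ∀ k : Fin 4, E.IsInteriorEdge u k)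
    (hpair : ∀ k : Fin 4, Hb (faceAt u k) - Hw u = dartFlux E hE (u, k) ∧
      Hb (faceAt u k) - Hw (u + cornerUnit k) = dartFlux E hE (u + cornerUnit k, k + 1)) :
    latticeLaplacian Hw u = -((eighthPhase 1).re ^ 2 *
      ‖fkIsingObservable E criticalFKIsingParam (cSrc (u, 0)) - fkIsingObservable E criticalFKIsingParam (cSrc (u, 2))‖ ^ 2) := by
  set c₀ := DiscreteDobrushin.startCorner hE with hc₀
  set G : MedialVertex → ℂ := fun z => refPhase c₀ * fkIsingObservable E criticalFKIsingParam z with hG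
  -- increments of `Hw` along the edges at `u`
  have hinc : ∀ k : Fin 4, Hw (u + cornerUnit k) - Hw u = dartFlux E hE (u, k) - dartFlux E hE (u + cornerUnit k, k + 1) := by
    intro k; have h1 := (hpair k).1; have h2 := (hpair k).2; linarith
  -- the eight fluxes in terms of `G` at the edges `e_k`
  have hsrc : ∀ k : Fin 4, dartFlux E hE (u, k) = fluxConst c₀ * cornerFlux G (u, k) :=
    fun k => dartFlux_eq_source hE hA (hint k)
  have htgt : ∀ k : Fin 4, dartFlux E hE (u + cornerUnit k, k + 1) = fluxConst c₀ *
      ‖projLine (cornerLine (u + cornerUnit k) (faceAt (u + cornerUnit k) (k + 1))) (G (cSrc (u, k)))‖ ^ 2 := by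
    intro k
    have h := dartFlux_eq_target hE hA (p := (u + cornerUnit k, k + 1))
      (by simp only [show k + 1 + 1 = k + 2 by omega]; exact (hint k).reverse)
    rw [cTgt_add_cornerUnit_succ] at h
    exact h
  -- s-holomorphicity of `G` at the four corners of `u`
  have hs : ∀ k : Fin 4, IsSHolAt G (u, k) := fun k => isSHolAt_refPhase hE hA (hint k) (hint (k + 1))
  have key := sum_vertexStep_eq_neg_norm_sq' G u hs
  rw [latticeLaplacian, Finset.sum_congr rfl fun k _ => hinc k]
  simp_rw [hsrc, htgt, ← mul_sub]
  rw [← Finset.mul_sum, key]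
  have hn : ‖G (cSrc (u, 0)) - G (cSrc (u, 2))‖ ^ 2 =
      ‖refPhase c₀‖ ^ 2 * ‖fkIsingObservable E criticalFKIsingParam (cSrc (u, 0)) - fkIsingObservable E criticalFKIsingParam (cSrc (u, 2))‖ ^ 2 := by
    simp only [hG]; rw [← mul_sub, norm_mul, mul_pow]
  rw [hn, fluxConst]
  have hR : ‖refPhase c₀‖ ≠ 0 := norm_ne_zero_iff.2 (refPhase_ne_zero c₀)
  field_simp

/-- **Lemma 3.8 (black squares) for the FK primitive.** Let `(Hw, Hb)` have the primitive property
at the eight darts around the face `f` (its four corners' darts `(f + cornerOff j, j)` and the four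
darts `(f + cornerOff j, j + 3)` into the neighbouring faces), and let the four sides of `f` be
interior. Then `Δ Hb (f) = κ² ‖F(E₀) - F(E₂)‖² ≥ 0`. [cite: Smirnov2010, Lemma 3.8] -/
theorem latticeLaplacian_hb_eq (hE : E.IsZdAdmissible) [Fintype (meshDomain E.Ω E.δ)]
    (hA : ((discreteDomainGraph E.Ω E.δ).induce E.zdArcA).Preconnected) {Hw Hb : Site 2 → ℝ} (f : Site 2)
    (hint : ∀ j : Fin 4, E.IsInteriorEdge (f + cornerOff j) j)
    (hpair : ∀ j : Fin 4, Hb f - Hw (f + cornerOff j) = dartFlux E hE (f + cornerOff j, j) ∧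
      Hb (f + cornerUnit (j + 3)) - Hw (f + cornerOff j) = dartFlux E hE (f + cornerOff j, j + 3)) :
    latticeLaplacian Hb f = (eighthPhase 1).re ^ 2 *
      ‖fkIsingObservable E criticalFKIsingParam (cSrc (f + cornerOff 0, 0)) -
        fkIsingObservable E criticalFKIsingParam (cSrc (f + cornerOff 2, 2))‖ ^ 2 := by
  set c₀ := DiscreteDobrushin.startCorner hE with hc₀
  set G : MedialVertex → ℂ := fun z => refPhase c₀ * fkIsingObservable E criticalFKIsingParam z with hG
  have hinc : ∀ j : Fin 4, Hb (f + cornerUnit (j + 3)) - Hb f =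
      dartFlux E hE (f + cornerOff j, j + 3) - dartFlux E hE (f + cornerOff j, j) := by
    intro j; have h1 := (hpair j).1; have h2 := (hpair j).2; linarith
  have hsrc : ∀ j : Fin 4, dartFlux E hE (f + cornerOff j, j) = fluxConst c₀ * cornerFlux G (f + cornerOff j, j) :=
    fun j => dartFlux_eq_source hE hA (hint j)
  have htgt : ∀ j : Fin 4, dartFlux E hE (f + cornerOff j, j + 3) = fluxConst c₀ *
      ‖projLine (cornerLine (f + cornerOff j) (faceAt (f + cornerOff j) (j + 3))) (G (cSrc (f + cornerOff j, j)))‖ ^ 2 := by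
    intro j
    have h := dartFlux_eq_target hE hA (p := (f + cornerOff j, j + 3))
      (by simp only [show j + 3 + 1 = j by omega]; exact hint j)
    rw [cTgt_add_three] at h
    exact h
  -- the side `E_{j+3}` seen from the corner `f + cornerOff j`
  have hside : ∀ j : Fin 4, E.IsInteriorEdge (f + cornerOff j) (j + 1) := by
    intro j
    have h := (hint (j + 3)).reverse
    rw [add_assoc, cornerOff_add_three_add_cornerUnit, show j + 3 + 2 = j + 1 by omega] at h
    exact h
  have hs : ∀ j : Fin 4, IsSHolAt G (f + cornerOff j, j) := fun j => isSHolAt_refPhase hE hA (hint j) (hside j)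
  have key := sum_faceStep_eq_norm_sq' G f hs
  rw [latticeLaplacian]
  rw [show ∑ k : Fin 4, (Hb (f + cornerUnit k) - Hb f) = ∑ j : Fin 4, (Hb (f + cornerUnit (j + 3)) - Hb f) from
    (Fintype.sum_equiv (Equiv.addRight (3 : Fin 4)) (fun j => Hb (f + cornerUnit (j + 3)) - Hb f)
      (fun k => Hb (f + cornerUnit k) - Hb f) fun j => rfl).symm]
  rw [Finset.sum_congr rfl fun j _ => hinc j]
  simp_rw [hsrc, htgt, ← mul_sub]
  rw [← Finset.mul_sum, key]
  have hn : ‖G (cSrc (f + cornerOff 0, 0)) - G (cSrc (f + cornerOff 2, 2))‖ ^ 2 =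
      ‖refPhase c₀‖ ^ 2 * ‖fkIsingObservable E criticalFKIsingParam (cSrc (f + cornerOff 0, 0)) -
        fkIsingObservable E criticalFKIsingParam (cSrc (f + cornerOff 2, 2))‖ ^ 2 := by
    simp only [hG]; rw [← mul_sub, norm_mul, mul_pow]
  rw [hn, fluxConst]
  have hR : ‖refPhase c₀‖ ≠ 0 := norm_ne_zero_iff.2 (refPhase_ne_zero c₀)
  field_simp

/-- **`Hw` is superharmonic one step inside the arcs**: `Δ Hw ≤ 0` at every site whose four edges
are interior, for any pair with the primitive property around it. [cite: Smirnov2010, Lemma 3.8] -/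
theorem superharmonic_hw (hE : E.IsZdAdmissible) [Fintype (meshDomain E.Ω E.δ)]
    (hA : ((discreteDomainGraph E.Ω E.δ).induce E.zdArcA).Preconnected) {Hw Hb : Site 2 → ℝ} {S : Set (Site 2)}
    (hint : ∀ u ∈ S, ∀ k : Fin 4, E.IsInteriorEdge u k)
    (hpair : ∀ u ∈ S, ∀ k : Fin 4, Hb (faceAt u k) - Hw u = dartFlux E hE (u, k) ∧
      Hb (faceAt u k) - Hw (u + cornerUnit k) = dartFlux E hE (u + cornerUnit k, k + 1)) :
    IsLatticeSuperharmonicOn Hw S := fun u hu => by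
  rw [latticeLaplacian_hw_eq hE hA u (hint u hu) (hpair u hu)]
  exact neg_nonpos.2 (mul_nonneg (sq_nonneg _) (sq_nonneg _))

/-- **`Hb` is subharmonic one step inside the arcs**: `Δ Hb ≥ 0` at every face whose four sides are
interior, for any pair with the primitive property around it. [cite: Smirnov2010, Lemma 3.8] -/
theorem subharmonic_hb (hE : E.IsZdAdmissible) [Fintype (meshDomain E.Ω E.δ)]
    (hA : ((discreteDomainGraph E.Ω E.δ).induce E.zdArcA).Preconnected) {Hw Hb : Site 2 → ℝ} {S : Set (Site 2)}
    (hint : ∀ f ∈ S, ∀ j : Fin 4, E.IsInteriorEdge (f + cornerOff j) j)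
    (hpair : ∀ f ∈ S, ∀ j : Fin 4, Hb f - Hw (f + cornerOff j) = dartFlux E hE (f + cornerOff j, j) ∧
      Hb (f + cornerUnit (j + 3)) - Hw (f + cornerOff j) = dartFlux E hE (f + cornerOff j, j + 3)) :
    IsLatticeSubharmonicOn Hb S := fun f hf => by
  rw [latticeLaplacian_hb_eq hE hA f (hint f hf) (hpair f hf)]
  exact mul_nonneg (sq_nonneg _) (sq_nonneg _)

end Laplacian

end Literature.Probability.LatticeModels
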